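import Mathlib.Analysis.SpecialFunctions.Pow.Real
import Mathlib.Analysis.SpecialFunctions.Sqrt
import Mathlib.Analysis.SpecialFunctions.Trigonometric.Basic
import Literature.Geometry.Lorentzian.KerrSchild

/-!
# Klainerman–Szeftel, *Kerr stability for small angular momentum*, App. D.3: the spacelike time
# function `τ = u̲ + f(r)` — the polynomial inequalities, for ALL `a² ≤ m²`

CITATION HEADER (lean-in-tree rule 2026-08-18). This module is a kernel REPRODUCTION of the
elementary real inequalities printed in

* S. Klainerman, J. Szeftel, *Kerr stability for small angular momentum*, arXiv:2104.11857 (v1, 2021;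
  the only arXiv version; TeX source `Main-Kerr-arxiv.tex`, whose lines are quoted as `KS l.N`)
  = bib key `KlainermanSzeftel2021`; journal version Pure Appl. Math. Q. **19** (2023) 791–1678
  = bib key `KlainermanSzeftel2023` (refereed; not separately read — the appendix numbering below is
  the arXiv numbering reconstructed from the TeX counters: App. D.3 = "Proof of Proposition 9.3.5",
  Lemma D.3.6 `KS l.31964–31969`, display (D.3.21) `KS l.31989–31991`, Lemma D.3.7 `KS l.31994–32004`,
  Lemma D.3.9 `KS l.32053–32095` with proof `KS l.32097–32216`, Corollary D.3.10 `KS l.32219–32232`).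

WHAT IS REPRODUCED. Proposition 9.3.5 of the paper supplies the time function `τ` whose level sets
foliate the region `r ≥ r₊ − δ_H` used in chapter 9 (Theorem M8); App. D.3 constructs it in Kerr as
`τ := u̲ + f(r)` and reduces its spacelike character to the sign of the quadratic polynomial
`P(X) := Δ X² + 2(r² + a²) X + a²`, `Δ = r² − 2mr + a²` (Lemma D.3.6: `|q|² g(Dτ, Dτ) =
Δ f'² + 2(r² + a²) f' + a² sin²θ`), evaluated at `f₁'(r) = −m²/r²` (near and inside the horizon)
and `f₂'(r) = −2 − 4m/r + m²/r²` (far region), and at their convex combinations. This file proves,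
sorry-free and for **every** `a² ≤ m²` (no smallness of `a/m`):

* `P_df₁_le_of_sq_le` / `P_df₁_le_of_delta_nonpos` / `P_df₁_le_of_rMinus_le`: Lemma D.3.9 item 5,
  first bullet, `P(f₁'(r)) ≤ −m²/4` — in fact with the sharper constant `−m²` (the printed proof
  obtains `−m²/4` for `r > r₊` through the roots `X_±` and `−m²` for `Δ ≤ 0`; here an exact identity,
  `r⁴ (P(f₁') + m²) = −(m² − a²)(r² − m²)² − m⁴(r² + 2mr − m²)`, gives `−m²` on the whole range
  `r ≥ r₋`);
* `P_df₂_le`: second bullet, `P(f₂'(r)) ≤ −8m²` for `r ≥ r₀` — printed "for `r₀` large enough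
  compared to `m`" via the expansion `−2(9m² − a²/2) + O(m³/r)`; proved here for every `r ≥ m`
  from the exact quartic `r⁴ (P(f₂') + 8m²)`;
* `P_convexComb_eq` / `P_convexComb_df_le`: third bullet (convexity of `P` in `X` for `Δ ≥ 0`);
* `gradSqNum_eq` / `gradSqNum_le` / `gradSq_le`: Corollary D.3.10 item 3,
  `g(Dτ, Dτ) ≤ −(m² + 4a² cos²θ)/(4|q|²) < 0`, from `P(f') ≤ −m²/4`;
* `discr_eq`, `XPlus_eq_div`, `P_eq_mul_roots`, `P_neg_iff`: Lemma D.3.7 (the roots `X_±(r)` in the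
  printed closed forms and `P(X) < 0 ↔ X₋ < X < X₊` for `Δ > 0`);
* `df₁_sub_df₂`, `df₂_lt_df₁`: Lemma D.3.9 item 1 (`f₁' > f₂'`).

Items 2–4 of Lemma D.3.9 (the crossing radius `r₁ ∈ (r₀, r₀ + m)`, which involve the
integration constant `c_{0,*}` and `O(·)`-expansions) and items 1–2 of Corollary D.3.10 (the smooth
gluing of `f₁`, `f₂`) are not transcribed.

WHY (audit context, not a claim about the paper's main theorem). Written by the audit cell `pub-kerr`
(Final State Conjecture near-miss cell 6; `|a| ≪ M` census of the Klainerman–Szeftel /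
Giorgi–Klainerman–Szeftel proof, file `ADEP.md` row A3.9): App. D.3 is the only place in the paper
where an inequality between `a` and `m` is invoked, and each printed step uses exactly `a² ≤ m²`
(`2m² − a² ≥ m²`, `−2m² + a² ≤ −m²`); the kernel confirms that these inequalities hold uniformly on
the closed range `|a| ≤ m`. One reading made explicit: the printed case split of the first bullet
("for `r > r₊`" / "for `r₊ − δ_H ≤ r ≤ r₊`, `P(f₁') = −|Δ| f₁'² + …`", `KS l.32163–32181`) treats
`Δ ≤ 0` on `[r₊ − δ_H, r₊]`, i.e. it reads `δ_H ≤ r₊ − r₋ = 2√(m² − a²)`; `P_df₁_le_printedDomain`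
carries that hypothesis explicitly (compare the constants line `KS l.6078`, `δ_H ≪ min{m₀, 1}`, with
Giorgi–Klainerman–Szeftel arXiv:2205.14808 `l.1698`, `δ_H ≪ min{m₀ − |a₀|, 1}`). Nothing in this
file is a named fact; every declaration is a definition transcribing a printed formula or a theorem
proved here. Horizon radii are the tree's `Kerr.rPlus`, `Kerr.rMinus` (`KerrSchild.lean`).

## References

* S. Klainerman, J. Szeftel, arXiv:2104.11857v1, App. D.3 (Lemma D.3.6, (D.3.21), Lemma D.3.7,
  Lemma D.3.9, Corollary D.3.10), Proposition 9.3.5. Bib keys `KlainermanSzeftel2021`,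
  `KlainermanSzeftel2023`.
-/

noncomputable section

namespace Literature.Geometry.Lorentzian.KlainermanSzeftel2021.SpacelikeTime

open Literature.Geometry.Lorentzian

/-! ## The printed objects -/

/-- `Δ = Δ(r) := r² − 2mr + a²` (Boyer–Lindquist), KS §2.4 (`KS l.2899`: `r₊ := m + √(m² − a²)`
is its larger root). [cite: KlainermanSzeftel2021, §2.4] -/
def delta (m a r : ℝ) : ℝ := r ^ 2 - 2 * m * r + a ^ 2

/-- The quadratic polynomial of App. D.3, display (D.3.21), `KS l.31989–31991`:
`P(X) := Δ X² + 2(r² + a²) X + a²`. [cite: KlainermanSzeftel2021, App. D.3 (D.3.21)] -/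
def P (m a r X : ℝ) : ℝ := delta m a r * X ^ 2 + 2 * (r ^ 2 + a ^ 2) * X + a ^ 2

/-- `f₁'(r) = −m²/r²` (Lemma D.3.9, `f₁(r) := m²/r − m²/(r₊ − δ_H)`, `KS l.32056`, `l.32099`).
[cite: KlainermanSzeftel2021, App. D.3 Lemma D.3.9] -/
def df₁ (m r : ℝ) : ℝ := -(m ^ 2 / r ^ 2)

/-- `f₂'(r) = −2 − 4m/r + m²/r²` (Lemma D.3.9, `f₂(r) := −2(r − r₀) − 4m log(r/r₀) − m²/r + c_{0,*}`,
`KS l.32057`, `l.32100`). [cite: KlainermanSzeftel2021, App. D.3 Lemma D.3.9] -/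
def df₂ (m r : ℝ) : ℝ := -2 - 4 * m / r + m ^ 2 / r ^ 2

/-- `|q|² = r² + a² cos²θ` (KS §2.4, `q = r + i a cos θ`). [cite: KlainermanSzeftel2021, §2.4] -/
def qSq (a r θ : ℝ) : ℝ := r ^ 2 + a ^ 2 * Real.cos θ ^ 2

/-- The numerator of `g(Dτ, Dτ)` for `τ = u̲ + f(r)`, Lemma D.3.6 (`KS l.31964–31969`):
`|q|² g(Dτ, Dτ) = Δ (f')² + 2(r² + a²) f' + a² sin²θ`; here `fp` stands for `f'(r)`.
[cite: KlainermanSzeftel2021, App. D.3 Lemma D.3.6] -/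
def gradSqNum (m a r fp θ : ℝ) : ℝ :=
  delta m a r * fp ^ 2 + 2 * (r ^ 2 + a ^ 2) * fp + a ^ 2 * Real.sin θ ^ 2

/-- The radicand of Lemma D.3.7: `r⁴ + a² r² + 2a² m r` (`= D_P/4`, `KS l.32009–32013`).
[cite: KlainermanSzeftel2021, App. D.3 Lemma D.3.7] -/
def radicand (m a r : ℝ) : ℝ := r ^ 4 + a ^ 2 * r ^ 2 + 2 * a ^ 2 * m * r

/-- The smaller root `X₋(r) := −(r² + a²)/Δ − √(r⁴ + a²r² + 2a²mr)/Δ`, as printed in Lemma D.3.7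
(`KS l.32000`). [cite: KlainermanSzeftel2021, App. D.3 Lemma D.3.7] -/
def XMinus (m a r : ℝ) : ℝ :=
  -(r ^ 2 + a ^ 2) / delta m a r - Real.sqrt (radicand m a r) / delta m a r

/-- The larger root `X₊(r) := −a²/(r² + a² + √(r⁴ + a²r² + 2a²mr))`, as printed in Lemma D.3.7
(`KS l.32001`). [cite: KlainermanSzeftel2021, App. D.3 Lemma D.3.7] -/
def XPlus (m a r : ℝ) : ℝ := -a ^ 2 / (r ^ 2 + a ^ 2 + Real.sqrt (radicand m a r))

/-! ## Elementary identities -/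

/-- Unfolding lemma for `Δ` (KS §2.4). [cite: KlainermanSzeftel2021, §2.4] -/
theorem delta_def (m a r : ℝ) : delta m a r = r ^ 2 - 2 * m * r + a ^ 2 := rfl

/-- Unfolding lemma for `P`, display (D.3.21), `KS l.31989–31991`.
[cite: KlainermanSzeftel2021, App. D.3 (D.3.21)] -/
theorem P_def (m a r X : ℝ) :
    P m a r X = delta m a r * X ^ 2 + 2 * (r ^ 2 + a ^ 2) * X + a ^ 2 := rfl

/-- `Δ = (r − r₋)(r − r₊)` for `a² ≤ m²` (KS §2.4, `KS l.2899`; the tree's `Kerr.rPlus`,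
`Kerr.rMinus`). [cite: KlainermanSzeftel2021, §2.4] -/
theorem delta_eq_mul_horizons {m a : ℝ} (ha : a ^ 2 ≤ m ^ 2) (r : ℝ) :
    delta m a r = (r - Kerr.rMinus m a) * (r - Kerr.rPlus m a) := by
  have hs : Real.sqrt (m ^ 2 - a ^ 2) ^ 2 = m ^ 2 - a ^ 2 := Real.sq_sqrt (sub_nonneg.2 ha)
  unfold delta Kerr.rMinus Kerr.rPlus
  linear_combination hs

/-- Between the horizons `Δ ≤ 0`: `r₋ ≤ r ≤ r₊ → Δ(r) ≤ 0`, for `a² ≤ m²`.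
[cite: KlainermanSzeftel2021, §2.4] -/
theorem delta_nonpos_of_mem {m a r : ℝ} (ha : a ^ 2 ≤ m ^ 2) (h₁ : Kerr.rMinus m a ≤ r)
    (h₂ : r ≤ Kerr.rPlus m a) : delta m a r ≤ 0 := by
  rw [delta_eq_mul_horizons ha]
  exact mul_nonpos_of_nonneg_of_nonpos (sub_nonneg.2 h₁) (sub_nonpos.2 h₂)

/-- `m ≤ r₊` and `r₋ ≤ m` (the horizons straddle `r = m`). [cite: KlainermanSzeftel2021, §2.4] -/
theorem rMinus_le_self_le_rPlus (m a : ℝ) : Kerr.rMinus m a ≤ m ∧ m ≤ Kerr.rPlus m a := by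
  unfold Kerr.rMinus Kerr.rPlus
  constructor <;> linarith [Real.sqrt_nonneg (m ^ 2 - a ^ 2)]

/-- `Δ ≥ 0` for `r ≥ 2m` (indeed `Δ = r(r − 2m) + a²`); in particular on the far region `r ≥ r₀`,
`r₀ ≫ m`, where the third bullet of Lemma D.3.9 is used. [cite: KlainermanSzeftel2021, App. D.3 Lemma D.3.9] -/
theorem delta_nonneg_of_two_mul_le {m a r : ℝ} (hm : 0 ≤ m) (hr : 2 * m ≤ r) :
    0 ≤ delta m a r := by
  unfold delta
  nlinarith [sq_nonneg a, mul_nonneg hm (sub_nonneg.2 hr)]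

/-! ## Lemma D.3.9, item 1: `f₁' > f₂'` -/

/-- `f₁'(r) − f₂'(r) = 2(r² + 2mr − m²)/r²` (`KS l.32104–32106`).
[cite: KlainermanSzeftel2021, App. D.3 Lemma D.3.9 (1)] -/
theorem df₁_sub_df₂ {m r : ℝ} (hr : r ≠ 0) :
    df₁ m r - df₂ m r = 2 * (r ^ 2 + 2 * m * r - m ^ 2) / r ^ 2 := by
  unfold df₁ df₂
  field_simp
  ring

/-- Lemma D.3.9 item 1 (`KS l.32062–32065`, proof `l.32104–32109`): `f₁'(r) > f₂'(r)` as soon as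
`r² + 2mr − m² > 0`, i.e. `r > (√2 − 1)m` — which contains the printed domain `r ≥ r₊ − δ_H` since
`r₊ ≥ m` and `δ_H ≪ m`. [cite: KlainermanSzeftel2021, App. D.3 Lemma D.3.9 (1)] -/
theorem df₂_lt_df₁ {m r : ℝ} (hr : 0 < r) (h : 0 < r ^ 2 + 2 * m * r - m ^ 2) :
    df₂ m r < df₁ m r := by
  have hr2 : 0 < r ^ 2 := by positivity
  have key : df₁ m r - df₂ m r = 2 * (r ^ 2 + 2 * m * r - m ^ 2) / r ^ 2 := df₁_sub_df₂ hr.ne'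
  have : 0 < df₁ m r - df₂ m r := by rw [key]; positivity
  linarith

/-- In particular `f₁' > f₂'` for every `r ≥ m/2` when `m > 0` (then `r² + 2mr − m² ≥ m²/4 > 0`).
[cite: KlainermanSzeftel2021, App. D.3 Lemma D.3.9 (1)] -/
theorem df₂_lt_df₁_of_half_le {m r : ℝ} (hm : 0 < m) (hr : m / 2 ≤ r) : df₂ m r < df₁ m r :=
  df₂_lt_df₁ (by linarith) (by nlinarith)

/-! ## Lemma D.3.9, item 5, first bullet: `P(f₁'(r)) ≤ −m²/4` (here: `≤ −m²`) -/

/-- Exact identity behind the first bullet: `r⁴ (P(f₁'(r)) + m²) = −(m² − a²)(r² − m²)² −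
m⁴ (r² + 2mr − m²)` (replaces the printed route through `X_±`, `KS l.32139–32175`).
[cite: KlainermanSzeftel2021, App. D.3 Lemma D.3.9 (5)] -/
theorem rpow4_mul_P_df₁_add (m a : ℝ) {r : ℝ} (hr : r ≠ 0) :
    r ^ 4 * (P m a r (df₁ m r) + m ^ 2) =
      -(m ^ 2 - a ^ 2) * (r ^ 2 - m ^ 2) ^ 2 - m ^ 4 * (r ^ 2 + 2 * m * r - m ^ 2) := by
  unfold P delta df₁
  field_simp
  ring

/-- First bullet, outside the inner region: for `a² ≤ m²`, `r > 0` and `r² + 2mr − m² ≥ 0`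
(e.g. every `r ≥ (√2 − 1) m`, so every `r ≥ r₊ ≥ m`): `P(f₁'(r)) ≤ −m²` (printed: `≤ −m²/4` for
`r > r₊`, `KS l.32170–32175`). [cite: KlainermanSzeftel2021, App. D.3 Lemma D.3.9 (5)] -/
theorem P_df₁_le_of_sq_le {m a r : ℝ} (ha : a ^ 2 ≤ m ^ 2) (hr : 0 < r)
    (h : 0 ≤ r ^ 2 + 2 * m * r - m ^ 2) : P m a r (df₁ m r) ≤ -m ^ 2 := by
  have hid := rpow4_mul_P_df₁_add m a hr.ne'
  have h1 : 0 ≤ (m ^ 2 - a ^ 2) * (r ^ 2 - m ^ 2) ^ 2 :=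
    mul_nonneg (sub_nonneg.2 ha) (sq_nonneg _)
  have h2 : 0 ≤ m ^ 4 * (r ^ 2 + 2 * m * r - m ^ 2) := mul_nonneg (by positivity) h
  have hneg : r ^ 4 * (P m a r (df₁ m r) + m ^ 2) ≤ 0 := by rw [hid]; linarith
  have hr4 : 0 < r ^ 4 := by positivity
  by_contra hcon
  push Not at hcon
  have : 0 < r ^ 4 * (P m a r (df₁ m r) + m ^ 2) := mul_pos hr4 (by linarith)
  linarith

/-- First bullet, between the horizons — the printed computation `KS l.32176–32181`
("`P(f₁') = −|Δ| (f₁')² + 2(r² + a²) f₁' + a² ≤ 2(r² + a²)(−m²/r²) + a² ≤ −2m² + a² ≤ −m²`"):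
for `Δ(r) ≤ 0`, `r > 0`, `a² ≤ m²`, `P(f₁'(r)) ≤ −m²`. [cite: KlainermanSzeftel2021, App. D.3 Lemma D.3.9 (5)] -/
theorem P_df₁_le_of_delta_nonpos {m a r : ℝ} (ha : a ^ 2 ≤ m ^ 2) (hr : 0 < r)
    (hΔ : delta m a r ≤ 0) : P m a r (df₁ m r) ≤ -m ^ 2 := by
  have hr2 : 0 < r ^ 2 := by positivity
  -- `Δ (f₁')² ≤ 0`
  have t1 : delta m a r * df₁ m r ^ 2 ≤ 0 := mul_nonpos_of_nonpos_of_nonneg hΔ (sq_nonneg _)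
  -- `2(r² + a²) f₁' = −2m² − 2a²m²/r² ≤ −2m²`
  have t2 : 2 * (r ^ 2 + a ^ 2) * df₁ m r ≤ -(2 * m ^ 2) := by
    have e : 2 * (r ^ 2 + a ^ 2) * df₁ m r = -(2 * m ^ 2) - 2 * a ^ 2 * m ^ 2 / r ^ 2 := by
      unfold df₁; field_simp; ring
    rw [e]
    have : 0 ≤ 2 * a ^ 2 * m ^ 2 / r ^ 2 := by positivity
    linarith
  unfold P
  nlinarith

/-- First bullet on the whole range `r ≥ r₋` (for `0 < m`, `a² ≤ m²`, `r > 0`): `P(f₁'(r)) ≤ −m²`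
— by `P_df₁_le_of_delta_nonpos` on `[r₋, r₊]` and `P_df₁_le_of_sq_le` on `[m, ∞)`.
[cite: KlainermanSzeftel2021, App. D.3 Lemma D.3.9 (5)] -/
theorem P_df₁_le_of_rMinus_le {m a r : ℝ} (hm : 0 < m) (ha : a ^ 2 ≤ m ^ 2) (hr : 0 < r)
    (h : Kerr.rMinus m a ≤ r) : P m a r (df₁ m r) ≤ -m ^ 2 := by
  by_cases hrm : m ≤ r
  · exact P_df₁_le_of_sq_le ha hr (by nlinarith)
  · push Not at hrm
    have hΔ : delta m a r ≤ 0 :=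
      delta_nonpos_of_mem ha h (hrm.le.trans (rMinus_le_self_le_rPlus m a).2)
    exact P_df₁_le_of_delta_nonpos ha hr hΔ

/-- The first bullet AS PRINTED (`KS l.32079–32083`, `l.32182–32185`): "for all `r ≥ r₊ − δ_H`,
`P(f₁'(r)) ≤ −m²/4`", with the reading of the printed case split made explicit as the hypothesis
`δ_H ≤ r₊ − r₋` (so that `Δ ≤ 0` on `[r₊ − δ_H, r₊]`, `KS l.32176`), for all `0 < m`, `a² ≤ m²`
and `r > 0`. [cite: KlainermanSzeftel2021, App. D.3 Lemma D.3.9 (5)] -/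
theorem P_df₁_le_printedDomain {m a r δH : ℝ} (hm : 0 < m) (ha : a ^ 2 ≤ m ^ 2) (hr : 0 < r)
    (hδ : δH ≤ Kerr.rPlus m a - Kerr.rMinus m a) (h : Kerr.rPlus m a - δH ≤ r) :
    P m a r (df₁ m r) ≤ -(m ^ 2 / 4) := by
  have h' : Kerr.rMinus m a ≤ r := by linarith
  have := P_df₁_le_of_rMinus_le hm ha hr h'
  nlinarith [sq_nonneg m]

/-! ## Lemma D.3.9, item 5, second bullet: `P(f₂'(r)) ≤ −8m²` -/

/-- Exact quartic: `r⁴ P(f₂'(r)) = (a² − 18m²) r⁴ + (8a²m − 32m³) r³ + (17m⁴ + 14a²m²) r² −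
(2m⁵ + 8a²m³) r + a²m⁴`; its leading coefficient is the printed `−2 · (9m² − a²/2)`
(`KS l.32196–32204`). [cite: KlainermanSzeftel2021, App. D.3 Lemma D.3.9 (5)] -/
theorem rpow4_mul_P_df₂ (m a : ℝ) {r : ℝ} (hr : r ≠ 0) :
    r ^ 4 * P m a r (df₂ m r) =
      (a ^ 2 - 18 * m ^ 2) * r ^ 4 + (8 * a ^ 2 * m - 32 * m ^ 3) * r ^ 3 +
        (17 * m ^ 4 + 14 * a ^ 2 * m ^ 2) * r ^ 2 - (2 * m ^ 5 + 8 * a ^ 2 * m ^ 3) * r +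
          a ^ 2 * m ^ 4 := by
  unfold P delta df₂
  field_simp
  ring

/-- Second bullet (`KS l.32085–32088`, proof `l.32187–32205`: "`P(f₂'(r)) ≤ −(17/2) m² (1 + O(m/r₀))
≤ −8m²` for `r₀` large enough compared to `m`"): for `0 < m`, `a² ≤ m²` and EVERY `r ≥ m`,
`P(f₂'(r)) ≤ −8m²`. Proof: with `b = m² − a² ≥ 0`, `r⁴ (P(f₂') + 8m²) = −b (r⁴ + 8mr³ + 14m²r² −
8m³r + m⁴) − (11m⁶ + 56m⁵(r − m) + 95m⁴(r − m)² + 60m³(r − m)³ + 9m²(r − m)⁴) ≤ 0`.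
[cite: KlainermanSzeftel2021, App. D.3 Lemma D.3.9 (5)] -/
theorem P_df₂_le {m a r : ℝ} (hm : 0 < m) (ha : a ^ 2 ≤ m ^ 2) (hr : m ≤ r) :
    P m a r (df₂ m r) ≤ -(8 * m ^ 2) := by
  have hr0 : 0 < r := hm.trans_le hr
  have hs : 0 ≤ r - m := sub_nonneg.2 hr
  have hb : 0 ≤ m ^ 2 - a ^ 2 := sub_nonneg.2 ha
  have hid : r ^ 4 * (P m a r (df₂ m r) + 8 * m ^ 2) =
      -((m ^ 2 - a ^ 2) * (r ^ 4 + 8 * m * r ^ 3 + 14 * m ^ 2 * r ^ 2 - 8 * m ^ 3 * r + m ^ 4)) -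
        (11 * m ^ 6 + 56 * m ^ 5 * (r - m) + 95 * m ^ 4 * (r - m) ^ 2 + 60 * m ^ 3 * (r - m) ^ 3 +
          9 * m ^ 2 * (r - m) ^ 4) := by
    rw [mul_add, rpow4_mul_P_df₂ m a hr0.ne']
    ring
  have hq : 0 ≤ r ^ 4 + 8 * m * r ^ 3 + 14 * m ^ 2 * r ^ 2 - 8 * m ^ 3 * r + m ^ 4 := by
    have h14 : 0 ≤ 14 * m ^ 2 * r ^ 2 - 8 * m ^ 3 * r := by nlinarith [mul_nonneg hm.le hs]
    nlinarith [h14, pow_nonneg hr0.le 4, mul_nonneg hm.le (pow_nonneg hr0.le 3), pow_nonneg hm.le 4]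
  have h1 : 0 ≤ (m ^ 2 - a ^ 2) *
      (r ^ 4 + 8 * m * r ^ 3 + 14 * m ^ 2 * r ^ 2 - 8 * m ^ 3 * r + m ^ 4) := mul_nonneg hb hq
  have h2 : 0 ≤ 11 * m ^ 6 + 56 * m ^ 5 * (r - m) + 95 * m ^ 4 * (r - m) ^ 2 +
      60 * m ^ 3 * (r - m) ^ 3 + 9 * m ^ 2 * (r - m) ^ 4 := by
    have e1 : 0 ≤ m ^ 6 := pow_nonneg hm.le 6
    have e2 : 0 ≤ m ^ 5 * (r - m) := mul_nonneg (pow_nonneg hm.le 5) hs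
    have e3 : 0 ≤ m ^ 4 * (r - m) ^ 2 := mul_nonneg (pow_nonneg hm.le 4) (pow_nonneg hs 2)
    have e4 : 0 ≤ m ^ 3 * (r - m) ^ 3 := mul_nonneg (pow_nonneg hm.le 3) (pow_nonneg hs 3)
    have e5 : 0 ≤ m ^ 2 * (r - m) ^ 4 := mul_nonneg (pow_nonneg hm.le 2) (pow_nonneg hs 4)
    linarith
  have hneg : r ^ 4 * (P m a r (df₂ m r) + 8 * m ^ 2) ≤ 0 := by rw [hid]; linarith
  have hr4 : 0 < r ^ 4 := by positivity
  by_contra hcon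
  push Not at hcon
  have : 0 < r ^ 4 * (P m a r (df₂ m r) + 8 * m ^ 2) := mul_pos hr4 (by linarith)
  linarith

/-! ## Lemma D.3.9, item 5, third bullet: convexity -/

/-- `P` is a quadratic in `X` with leading coefficient `Δ`: the exact convexity defect
`P(σx + (1 − σ)y) = σ P(x) + (1 − σ) P(y) − Δ σ(1 − σ)(x − y)²` ("`P'' = 2Δ > 0` hence `P` is
convex", `KS l.32207`). [cite: KlainermanSzeftel2021, App. D.3 Lemma D.3.9 (5)] -/
theorem P_convexComb_eq (m a r σ x y : ℝ) :
    P m a r (σ * x + (1 - σ) * y) =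
      σ * P m a r x + (1 - σ) * P m a r y - delta m a r * (σ * (1 - σ)) * (x - y) ^ 2 := by
  unfold P
  ring

/-- Convexity inequality for `Δ ≥ 0`, `0 ≤ σ ≤ 1` (`KS l.32207–32210`).
[cite: KlainermanSzeftel2021, App. D.3 Lemma D.3.9 (5)] -/
theorem P_convexComb_le {m a r σ x y : ℝ} (hΔ : 0 ≤ delta m a r) (h0 : 0 ≤ σ) (h1 : σ ≤ 1) :
    P m a r (σ * x + (1 - σ) * y) ≤ σ * P m a r x + (1 - σ) * P m a r y := by
  rw [P_convexComb_eq]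
  have : 0 ≤ delta m a r * (σ * (1 - σ)) * (x - y) ^ 2 :=
    mul_nonneg (mul_nonneg hΔ (mul_nonneg h0 (sub_nonneg.2 h1))) (sq_nonneg _)
  linarith

/-- Third bullet (`KS l.32090–32093`, proof `l.32207–32214`): for `0 ≤ σ ≤ 1` and `r ≥ r₀`
(here: every `r ≥ 2m`, which makes `Δ ≥ 0`), `P(σ f₁'(r) + (1 − σ) f₂'(r)) ≤ −m²/4`; indeed
`≤ σ(−m²) + (1 − σ)(−8m²) ≤ −m²`. [cite: KlainermanSzeftel2021, App. D.3 Lemma D.3.9 (5)] -/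
theorem P_convexComb_df_le {m a r σ : ℝ} (hm : 0 < m) (ha : a ^ 2 ≤ m ^ 2) (hr : 2 * m ≤ r)
    (h0 : 0 ≤ σ) (h1 : σ ≤ 1) :
    P m a r (σ * df₁ m r + (1 - σ) * df₂ m r) ≤ -m ^ 2 := by
  have hmr : m ≤ r := by linarith
  have hA := P_df₁_le_of_sq_le ha (hm.trans_le hmr) (by nlinarith)
  have hB := P_df₂_le hm ha hmr
  have hC := P_convexComb_le (m := m) (a := a) (r := r) (x := df₁ m r) (y := df₂ m r)
    (delta_nonneg_of_two_mul_le (a := a) hm.le hr) h0 h1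
  nlinarith [mul_nonneg h0 (sq_nonneg m), mul_nonneg (sub_nonneg.2 h1) (sq_nonneg m)]

/-- The three bullets of Lemma D.3.9 item 5 in their printed form (constants `−m²/4`, `−8m²`,
`−m²/4`), on the domains `r ≥ r₋` (⊇ the printed `r ≥ r₊ − δ_H` under `δ_H ≤ r₊ − r₋`), `r ≥ m`
(⊇ the printed `r ≥ r₀`, `r₀ ≫ m`) and `r ≥ 2m` (idem), for all `0 < m` and `a² ≤ m²`.
[cite: KlainermanSzeftel2021, App. D.3 Lemma D.3.9 (5)] -/
theorem lemma_D_3_9_item5 {m a : ℝ} (hm : 0 < m) (ha : a ^ 2 ≤ m ^ 2) :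
    (∀ r, 0 < r → Kerr.rMinus m a ≤ r → P m a r (df₁ m r) ≤ -(m ^ 2 / 4)) ∧
    (∀ r, m ≤ r → P m a r (df₂ m r) ≤ -(8 * m ^ 2)) ∧
    (∀ r σ, 2 * m ≤ r → 0 ≤ σ → σ ≤ 1 →
      P m a r (σ * df₁ m r + (1 - σ) * df₂ m r) ≤ -(m ^ 2 / 4)) := by
  refine ⟨fun r hr h => ?_, fun r hr => P_df₂_le hm ha hr, fun r σ hr h0 h1 => ?_⟩
  · have := P_df₁_le_of_rMinus_le hm ha hr h
    nlinarith [sq_nonneg m]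
  · have := P_convexComb_df_le hm ha hr h0 h1
    nlinarith [sq_nonneg m]

/-! ## Corollary D.3.10, item 3: the level sets of `τ` are spacelike -/

/-- Lemma D.3.6 rewritten: `|q|² g(Dτ, Dτ) = P(f') − a² cos²θ` (`sin² = 1 − cos²`).
[cite: KlainermanSzeftel2021, App. D.3 Lemma D.3.6] -/
theorem gradSqNum_eq (m a r fp θ : ℝ) :
    gradSqNum m a r fp θ = P m a r fp - a ^ 2 * Real.cos θ ^ 2 := by
  unfold gradSqNum P
  have := Real.sin_sq_add_cos_sq θ
  linear_combination a ^ 2 * this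

/-- Corollary D.3.10 item 3, numerator form (`KS l.32226–32228`): if `P(f'(r)) ≤ −m²/4` then
`|q|² g(Dτ, Dτ) ≤ −(m² + 4a² cos²θ)/4`. [cite: KlainermanSzeftel2021, App. D.3 Corollary D.3.10 (3)] -/
theorem gradSqNum_le {m a r fp θ : ℝ} (hP : P m a r fp ≤ -(m ^ 2 / 4)) :
    gradSqNum m a r fp θ ≤ -((m ^ 2 + 4 * a ^ 2 * Real.cos θ ^ 2) / 4) := by
  rw [gradSqNum_eq]
  linarith

/-- `|q|² = r² + a² cos²θ > 0` for `r ≠ 0`. [cite: KlainermanSzeftel2021, §2.4] -/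
theorem qSq_pos {a r : ℝ} (hr : r ≠ 0) (θ : ℝ) : 0 < qSq a r θ := by
  unfold qSq
  have : 0 < r ^ 2 := by positivity
  positivity

/-- Corollary D.3.10 item 3 as displayed (`KS l.32226–32228`):
`g(Dτ, Dτ) = (Δ f'² + 2(r² + a²) f' + a² sin²θ)/|q|² ≤ −(m² + 4a² cos²θ)/(4|q|²) < 0`, whenever
`P(f'(r)) ≤ −m²/4` (supplied for `f' ∈ {f₁', f₂', σf₁' + (1 − σ)f₂'}` by `lemma_D_3_9_item5`),
`m > 0`, `r ≠ 0`. [cite: KlainermanSzeftel2021, App. D.3 Corollary D.3.10 (3)] -/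
theorem gradSq_le {m a r fp θ : ℝ} (hm : 0 < m) (hr : r ≠ 0) (hP : P m a r fp ≤ -(m ^ 2 / 4)) :
    gradSqNum m a r fp θ / qSq a r θ ≤ -((m ^ 2 + 4 * a ^ 2 * Real.cos θ ^ 2) / (4 * qSq a r θ)) ∧
      gradSqNum m a r fp θ / qSq a r θ < 0 := by
  have hq := qSq_pos (a := a) hr θ
  have hnum := gradSqNum_le (θ := θ) hP
  have hc : 0 ≤ 4 * a ^ 2 * Real.cos θ ^ 2 := by positivity
  constructor
  · have h1 : gradSqNum m a r fp θ / qSq a r θ ≤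
        (-((m ^ 2 + 4 * a ^ 2 * Real.cos θ ^ 2) / 4)) / qSq a r θ :=
      (div_le_div_iff_of_pos_right hq).2 hnum
    have e : (-((m ^ 2 + 4 * a ^ 2 * Real.cos θ ^ 2) / 4)) / qSq a r θ =
        -((m ^ 2 + 4 * a ^ 2 * Real.cos θ ^ 2) / (4 * qSq a r θ)) := by
      field_simp
    rw [e] at h1
    exact h1
  · exact div_neg_of_neg_of_pos (by nlinarith [hnum, hc, pow_pos hm 2]) hq

/-! ## Lemma D.3.7: the roots `X_±` and the sign of `P` -/

/-- The discriminant computation of Lemma D.3.7 (`KS l.32009–32013`):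
`D_P = 4(r² + a²)² − 4a²Δ = 4(r⁴ + a²r² + 2a²mr)`. [cite: KlainermanSzeftel2021, App. D.3 Lemma D.3.7] -/
theorem discr_eq (m a r : ℝ) :
    (2 * (r ^ 2 + a ^ 2)) ^ 2 - 4 * delta m a r * a ^ 2 = 4 * radicand m a r := by
  unfold delta radicand
  ring

/-- The radicand is positive for `r > 0`, `m ≥ 0` ("`D_P(r) > 0` for any `r > 0`", `KS l.32014`).
[cite: KlainermanSzeftel2021, App. D.3 Lemma D.3.7] -/
theorem radicand_pos {m a r : ℝ} (hm : 0 ≤ m) (hr : 0 < r) : 0 < radicand m a r := by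
  unfold radicand
  have : 0 < r ^ 4 := by positivity
  have : 0 ≤ a ^ 2 * r ^ 2 := by positivity
  have : 0 ≤ 2 * a ^ 2 * m * r := by positivity
  linarith

/-- The printed closed form of `X₊` equals the quadratic-formula root
`(−(r² + a²) + √(r⁴ + a²r² + 2a²mr))/Δ` for `Δ ≠ 0` ("we may rewrite `X_±(r)` as …", `KS l.32018–32020`).
[cite: KlainermanSzeftel2021, App. D.3 Lemma D.3.7] -/
theorem XPlus_eq_div {m a r : ℝ} (hm : 0 ≤ m) (hr : 0 < r) (hΔ : delta m a r ≠ 0) :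
    XPlus m a r = (-(r ^ 2 + a ^ 2) + Real.sqrt (radicand m a r)) / delta m a r := by
  set S := Real.sqrt (radicand m a r) with hS
  have hS2 : S ^ 2 = radicand m a r := Real.sq_sqrt (radicand_pos hm hr).le
  have hS0 : 0 ≤ S := Real.sqrt_nonneg _
  have hden : 0 < r ^ 2 + a ^ 2 + S := by
    have : 0 < r ^ 2 := by positivity
    have : 0 ≤ a ^ 2 := sq_nonneg a
    linarith
  unfold XPlus
  rw [div_eq_div_iff hden.ne' hΔ]
  have key : S ^ 2 = (r ^ 2 + a ^ 2) ^ 2 - a ^ 2 * delta m a r := by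
    rw [hS2]; unfold radicand delta; ring
  linear_combination (-1 : ℝ) * key

/-- Lemma D.3.7, factorisation (`KS l.32014–32016`): for `Δ ≠ 0` (`r > 0`, `m ≥ 0`),
`P(X) = Δ (X − X₋(r))(X − X₊(r))`. [cite: KlainermanSzeftel2021, App. D.3 Lemma D.3.7] -/
theorem P_eq_mul_roots {m a r : ℝ} (hm : 0 ≤ m) (hr : 0 < r) (hΔ : delta m a r ≠ 0) (X : ℝ) :
    P m a r X = delta m a r * (X - XMinus m a r) * (X - XPlus m a r) := by
  rw [XPlus_eq_div hm hr hΔ]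
  unfold XMinus P
  have key : Real.sqrt (radicand m a r) ^ 2 = (r ^ 2 + a ^ 2) ^ 2 - a ^ 2 * delta m a r := by
    rw [Real.sq_sqrt (radicand_pos hm hr).le]; unfold radicand delta; ring
  field_simp
  linear_combination key

/-- `X₋ < X₊` for `Δ > 0` (two distinct roots, `KS l.32014–32016`).
[cite: KlainermanSzeftel2021, App. D.3 Lemma D.3.7] -/
theorem XMinus_lt_XPlus {m a r : ℝ} (hm : 0 ≤ m) (hr : 0 < r) (hΔ : 0 < delta m a r) :
    XMinus m a r < XPlus m a r := by
  rw [XPlus_eq_div hm hr hΔ.ne']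
  have hS : 0 < Real.sqrt (radicand m a r) := Real.sqrt_pos.2 (radicand_pos hm hr)
  unfold XMinus
  rw [← sub_div, div_lt_div_iff_of_pos_right hΔ]
  linarith

/-- Lemma D.3.7 (`KS l.31994–32004`): for `r > r₊` — here: whenever `Δ(r) > 0`, `r > 0`,
`m ≥ 0` — `P(X) < 0 ↔ X₋(r) < X < X₊(r)`. [cite: KlainermanSzeftel2021, App. D.3 Lemma D.3.7] -/
theorem P_neg_iff {m a r : ℝ} (hm : 0 ≤ m) (hr : 0 < r) (hΔ : 0 < delta m a r) (X : ℝ) :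
    P m a r X < 0 ↔ XMinus m a r < X ∧ X < XPlus m a r := by
  have hlt := XMinus_lt_XPlus hm hr hΔ
  rw [P_eq_mul_roots hm hr hΔ.ne', mul_assoc]
  constructor
  · intro h
    have h' : (X - XMinus m a r) * (X - XPlus m a r) < 0 := by
      by_contra hc
      push Not at hc
      have := mul_nonneg hΔ.le hc
      linarith
    rcases mul_neg_iff.1 h' with ⟨h1, h2⟩ | ⟨h1, h2⟩
    · exact ⟨by linarith, by linarith⟩
    · exfalso; linarith
  · rintro ⟨h1, h2⟩
    have : (X - XMinus m a r) * (X - XPlus m a r) < 0 :=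
      mul_neg_of_pos_of_neg (by linarith) (by linarith)
    exact mul_neg_of_pos_of_neg hΔ this

end Literature.Geometry.Lorentzian.KlainermanSzeftel2021.SpacelikeTime

end
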